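import Mathlib
import HarnessLib
import Summits.QuantumFields.Statement

/-!
# Sketch — crux ideas for `PauliWegnerSea.OneScaleTrajectory` (stmt-QuantumFields-11513), ideator 2, round 1

First lemmas of the two idea cards, stated over existing declarations (no new definitions):

* card `threshold-tuned-witness`: `PositiveMassNeumannDecay` (the deterministic anchor that makes
  the threshold up-set non-empty on EVERY torus) and `threshold_upset` (the order-theoretic core of
  the lever, proved);
* card `adjugate-anticoncentration-pin`: `AdjugateFibreSmallBall` (the K1-mirror: relative small
  balls for the two-star adjugate block) and `PowerMeanSandwich` (the Lyapunov step turning the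
  lower pin (iii) into a negative-moment bound).
-/

namespace Summit.QuantumFields.QCD.Cruxes.OneScaleTrajectory.Ideator2

open scoped BigOperators Topology Classical MeasureTheory Matrix
open Filter Set MeasureTheory

/-- Card `threshold-tuned-witness`, first lemma (deterministic anchor). For the tree's `r = 1`
Wilson–Dirac operator the hopping term is a sum of four unitaries (`(1 ∓ γ_μ)/2` are orthogonal
projectors), so for POSITIVE bare mass `m` the Neumann series in `K/(m+4)` converges for every
`SU(3)` background and every torus: the `(0, v)` colour–spin block of `D_W⁻¹` is bounded by
`(144/m)·(4/(4+m))^{‖v‖∞}` (the torus ℓ¹-distance from `0` to `proj v` is at least the sup norm of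
`v ∈ box S`). Consequence used by the card: every bare-mass tuple `≥ 2a_k/K` satisfies the one-scale
shell bound on ALL volumes, so the threshold up-set `U_k` is non-empty and `m_*(k) ≤ 2a_k/K`. -/
def PositiveMassNeumannDecay : Prop :=
  open Literature.MathematicalPhysics.QuantumFieldTheory Literature.MathematicalPhysics.QuantumLattice
    Literature.Probability.LatticeModels in
  ∀ (m : ℝ), 0 < m → ∀ (S : ℕ) (U : GaugeConfig 4 (2 * S + 1) (Matrix.specialUnitaryGroup (Fin 3) ℂ))
    (v : Literature.Probability.LatticeModels.Site 4), v ∈ box 4 S →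
    (∑ a : Fin 3, ∑ i : Fin 4, ∑ b : Fin 3, ∑ j : Fin 4,
        ‖(wilsonDirac (fundamentalRep (Fin 3)) U m 1)⁻¹ (Torus.proj (2 * S + 1) 0, a, i)
            (Torus.proj (2 * S + 1) v, b, j)‖) ≤ 144 / m * (4 / (4 + m)) ^ (‖v‖ : ℝ)

/-- Card `threshold-tuned-witness`, the lever's order-theoretic core (PROVED): if a property `P` of
a flavour-blind bare-mass floor is monotone upwards (it says "the shell bounds hold for every
bare-mass tuple componentwise above the floor", an up-set by construction) and holds at the floor
`1.9` (by `PositiveMassNeumannDecay`), then the threshold `m_* := inf {a ∈ [-1,2] | P a}` satisfies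
`-1 ≤ m_*` (clause (i) for free) and `P x` for every `x ∈ (m_*, 2]` (the one-scale clause for free
at every realised bare mass `m_* + a_k m_f / Z_m(k) > m_*`). -/
theorem threshold_upset (P : ℝ → Prop) (hup : ∀ a b : ℝ, P a → a ≤ b → b ≤ 2 → P b)
    (h19 : P 1.9) :
    -1 ≤ sInf {a : ℝ | -1 ≤ a ∧ a ≤ 2 ∧ P a} ∧
      ∀ x : ℝ, sInf {a : ℝ | -1 ≤ a ∧ a ≤ 2 ∧ P a} < x → x ≤ 2 → P x := by
  set U : Set ℝ := {a : ℝ | -1 ≤ a ∧ a ≤ 2 ∧ P a} with hU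
  have hne : U.Nonempty := ⟨1.9, by norm_num, by norm_num, h19⟩
  refine ⟨le_csInf hne fun a ha => ha.1, fun x hx hx2 => ?_⟩
  obtain ⟨a, ha, hax⟩ := exists_lt_of_csInf_lt hne hx
  exact hup a x ha.2.2 hax.le hx2

/-- Card `adjugate-anticoncentration-pin`, first lemma (the K1-mirror, β-free form). On the
two-star fibre of `x ≠ y` (links of `star x ∪ star y` resampled from product Haar, outside field
`U` frozen) the `(x,y)` colour–spin block of the ADJUGATE of the `r = 1` Wilson–Dirac matrix is a
band-limited function of each star link (bidegree `≤ (6,6)`, Pauli), hence obeys a RELATIVE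
small-ball (Remez / Carbery–Wright type) inequality with constants depending on the degree only:
`ν{ F ≤ ε · ‖F‖_{L²(ν)} } ≤ C ε^c`, `F(W) = Σ ‖adj(D(refit W))_{(x,a,i),(y,b,j)}‖`, uniformly in
the torus, the bare mass `m₀ ∈ [-2,2]`, the outside configuration and the pair `(x,y)`. -/
def AdjugateFibreSmallBall : Prop :=
  open Literature.MathematicalPhysics.QuantumFieldTheory Literature.MathematicalPhysics.QuantumLattice
    Literature.Probability.LatticeModels in
  ∃ C c : ℝ, 0 < C ∧ 0 < c ∧ ∀ (m₀ : ℝ), -2 ≤ m₀ → m₀ ≤ 2 → ∀ (L : ℕ) [NeZero L], 4 ≤ L →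
    ∀ (U : GaugeConfig 4 L (Matrix.specialUnitaryGroup (Fin 3) ℂ)) (x y : TorusSite 4 L), x ≠ y →
    let star : Edge 4 L → Prop := fun e =>
      e.1 = x ∨ Site.shift e.1 e.2 = x ∨ e.1 = y ∨ Site.shift e.1 e.2 = y
    let refit : GaugeConfig 4 L (Matrix.specialUnitaryGroup (Fin 3) ℂ) →
        GaugeConfig 4 L (Matrix.specialUnitaryGroup (Fin 3) ℂ) := fun W e => if star e then W e else U e
    let F : GaugeConfig 4 L (Matrix.specialUnitaryGroup (Fin 3) ℂ) → ℝ := fun W =>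
      ∑ a : Fin 3, ∑ i : Fin 4, ∑ b : Fin 3, ∑ j : Fin 4,
        ‖(wilsonDirac (fundamentalRep (Fin 3)) (refit W) m₀ 1).adjugate (x, a, i) (y, b, j)‖
    let haar : Measure (GaugeConfig 4 L (Matrix.specialUnitaryGroup (Fin 3) ℂ)) :=
      Measure.pi fun _ => haarProbability (Matrix.specialUnitaryGroup (Fin 3) ℂ)
    let M₂ : ℝ := Real.sqrt (∫ W, F W ^ 2 ∂haar)
    ∀ ε : ℝ, 0 < ε → (haar {W | F W ≤ ε * M₂}).toReal ≤ C * ε ^ c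

/-- Card `adjugate-anticoncentration-pin`, the Lyapunov (power-mean) step, abstract form: on a
probability space, for a positive random variable `X` and exponents `r, s > 0`,
`(E X^{-r})^{-s/r} ≤ E X^s` — so an UPPER bound on a negative moment of the phase-quenched
propagator block is a LOWER bound of the exact shape of clause (iii). (Jensen / monotonicity of
power means; stated, not re-proved here.) -/
def PowerMeanSandwich : Prop :=
  ∀ (Ω : Type) [MeasurableSpace Ω] (μ : Measure Ω) [IsProbabilityMeasure μ] (X : Ω → ℝ),
    Measurable X → (∀ ω, 0 < X ω) → ∀ r s : ℝ, 0 < r → 0 < s → s < 1 →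
    Integrable (fun ω => X ω ^ (-r)) μ → Integrable (fun ω => X ω ^ s) μ →
    (∫ ω, X ω ^ (-r) ∂μ) ^ (-(s / r)) ≤ ∫ ω, X ω ^ s ∂μ

end Summit.QuantumFields.QCD.Cruxes.OneScaleTrajectory.Ideator2
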